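import Mathlib
import HarnessLib
import Literature.MathematicalPhysics.QuantumLattice.LatticeWilsonFlow
import Summits.Ventures.LatticeQCDFlow.Scoring.WilsonFlowRK3

/-!
# Explicit bounds on the Wilson-flow generator and the RK3 registers: `‖P(W)‖ ≤ ‖W‖` (Frobenius), `‖Z(V)(x, μ)‖ ≤ 2(d − 1)√n` for every `SU(n)` configuration (`< 10.4` for the engine), and every exponent of one RK3 step has norm `≤ (19/9)·2(d − 1)√n·|ε|`

HONEST FRAMING: exact (Metropolis-corrected) sampling algorithms for lattice gauge theory;
figures of merit are autocorrelation/cost numbers at stated couplings and volumes; no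
continuum-physics claim.

Venture `LatticeQCDFlow` (cell pub-lqcd), sub-topic `Scoring`, FANOUT row 21 (`su3-base`).  The engine integrates Lüscher's flow
`V̇ = Z(V)V`, `Z(V)(x, μ) = −P(Ω_{x,μ}(V))` (row 16's `Scoring/WilsonFlowRK3.flowGen`, the Literature's `suProj` = `P` and
`plaquetteLoopSum` = `Ω`) with the RK3 scheme at step `ε` (HOME/su3-base/CARD-su3-base.md §3).  The tree's `Exactness/SUNWilsonHMCForce`
bounds `Ω` and `P` in the `ℓ∞` operator norm with the crude constants `2dN`, `(N + 1)`; this file gives the HILBERT–SCHMIDT (Frobenius)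
numbers — OUR WORK over Mathlib, the Literature's Frobenius inner product (`QuantumLattice.frobeniusInnerProductSpace`, used
proof-locally) and the two definitions; no definition, nothing cited as a fact:

* **`norm_half_sub_conjTranspose_le`** — `‖½(W − W†)‖ ≤ ‖W‖` (entrywise: `|w − w̄'|² ≤ 2(|w|² + |w'|²)`);
* **`norm_suProj_le`** — `‖P(W)‖ ≤ ‖W‖`: `P(W) = ½(W − W†) − c·1` with `c·1 ⊥ P(W)` because `tr P(W) = 0` (Pythagoras), then the above;
* **`norm_plaquetteLoopSum_le_frobenius`** — `‖Ω_{x,μ}(V)‖ ≤ 2(d − 1)√n`: `2(d − 1)` special-unitary staple products, each of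
  Frobenius norm `√n`;
* **`norm_flowGen_le`** — `‖Z(V)(x, μ)‖ ≤ 2(d − 1)√n` for EVERY configuration; in four dimensions `≤ 6√n`, and for `SU(3)`
  `6√3 < 52/5 = 10.4` (`norm_flowGen_su3_lt`): per unit flow time no link generator exceeds `10.4` in Hilbert–Schmidt norm, so an RK3
  stage of step `ε` rotates a link by a Lie-algebra element of norm `≤ (coefficient)·10.4·ε` — an assertion-grade invariant for the
  flow code, independent of `β`, `L`;
* **`norm_rkRegister_le`**, **`norm_rk3Registers_le`** — the registers of ONE RK3 step (row 16's `rkRegister` / `wilsonFlowRK3`: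
  `X₁ = ¼εZ(W₀)`, `X₂ = 8/9·εZ(W₁) − 17/9·X₁`, `X₃ = ¾εZ(W₂) − X₂`) obey `‖X₁‖ ≤ B/4`, `‖X₂‖ ≤ 49B/36`, `‖X₃‖ ≤ 19B/9` with
  `B = 2(d − 1)√n·|ε|`: every Lie-algebra element exponentiated onto a link in one step has norm `≤ (19/9)B` (`SU(3)`, `d = 4`:
  `< 22|ε|`, e.g. `< 0.44` at `ε = 0.02`).
NOT CLAIMED: sharpness; anything about the integrator's accuracy (row 16's `WilsonFlowRK3Consistency` / `…Rate`).
-/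

noncomputable section

open scoped Matrix.Norms.Frobenius
open Matrix

namespace Summit.Ventures.LatticeQCDFlow.Scoring

open Literature.MathematicalPhysics.QuantumFieldTheory

/-! ## §1 `‖P(W)‖ ≤ ‖W‖` -/

section SuProj

variable {n : ℕ}

/-- **`‖½(W − W†)‖ ≤ ‖W‖`**: the anti-Hermitian part does not exceed the matrix in Hilbert–Schmidt norm. -/
theorem norm_half_sub_conjTranspose_le (W : Matrix (Fin n) (Fin n) ℂ) : ‖(1 / 2 : ℂ) • (W - Wᴴ)‖ ≤ ‖W‖ := by
  letI : InnerProductSpace ℝ (Matrix (Fin n) (Fin n) ℂ) :=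
    Literature.MathematicalPhysics.QuantumLattice.frobeniusInnerProductSpace
  -- `‖M‖² = Σᵢⱼ |Mᵢⱼ|²` (the Literature's `frobenius_norm_sq_eq_sum_sq_norm_entry`, re-derived inline to keep imports light)
  have hsq : ∀ M : Matrix (Fin n) (Fin n) ℂ, ‖M‖ ^ 2 = ∑ i, ∑ j, ‖M i j‖ ^ 2 := fun M => by
    rw [← real_inner_self_eq_norm_sq, Literature.MathematicalPhysics.QuantumLattice.frobenius_inner_eq_sum]
    refine Finset.sum_congr rfl fun i _ => Finset.sum_congr rfl fun j _ => ?_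
    rw [Complex.conj_mul', ← Complex.ofReal_pow, Complex.ofReal_re]
  refine (pow_le_pow_iff_left₀ (norm_nonneg _) (norm_nonneg W) two_ne_zero).1 ?_
  rw [hsq, hsq W]
  have key : ∀ i j, ‖((1 / 2 : ℂ) • (W - Wᴴ)) i j‖ ^ 2 ≤ (‖W i j‖ ^ 2 + ‖W j i‖ ^ 2) / 2 := by
    intro i j
    simp only [Matrix.smul_apply, Matrix.sub_apply, Matrix.conjTranspose_apply, smul_eq_mul, norm_mul]
    have h1 : ‖W i j - star (W j i)‖ ≤ ‖W i j‖ + ‖W j i‖ := by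
      calc _ ≤ ‖W i j‖ + ‖star (W j i)‖ := norm_sub_le _ _
        _ = ‖W i j‖ + ‖W j i‖ := by rw [norm_star]
    have hn : ‖(1 / 2 : ℂ)‖ = 1 / 2 := by simp
    rw [hn]
    nlinarith [norm_nonneg (W i j), norm_nonneg (W j i), norm_nonneg (W i j - star (W j i)),
      sq_nonneg (‖W i j‖ - ‖W j i‖)]
  have hc : ∑ i : Fin n, ∑ j : Fin n, ‖W j i‖ ^ 2 = ∑ i, ∑ j, ‖W i j‖ ^ 2 := Finset.sum_comm
  have hsum : ∑ i, ∑ j, (‖W i j‖ ^ 2 + ‖W j i‖ ^ 2) / 2 =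
      (∑ i, ∑ j, ‖W i j‖ ^ 2 + ∑ i : Fin n, ∑ j : Fin n, ‖W j i‖ ^ 2) / 2 := by
    rw [← Finset.sum_add_distrib, Finset.sum_div]
    refine Finset.sum_congr rfl fun i _ => ?_
    rw [← Finset.sum_add_distrib, Finset.sum_div]
  calc ∑ i, ∑ j, ‖((1 / 2 : ℂ) • (W - Wᴴ)) i j‖ ^ 2 ≤ ∑ i, ∑ j, (‖W i j‖ ^ 2 + ‖W j i‖ ^ 2) / 2 :=
      Finset.sum_le_sum fun i _ => Finset.sum_le_sum fun j _ => key i j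
    _ = ∑ i, ∑ j, ‖W i j‖ ^ 2 := by rw [hsum, hc]; ring

/-- **`‖P(W)‖ ≤ ‖W‖`**: the projection onto `𝔰𝔲(n)` is a Hilbert–Schmidt contraction (`P(W) ⊥ c·1` since `tr P(W) = 0`,
then `norm_half_sub_conjTranspose_le`). -/
theorem norm_suProj_le (W : Matrix (Fin n) (Fin n) ℂ) : ‖suProj W‖ ≤ ‖W‖ := by
  letI : InnerProductSpace ℝ (Matrix (Fin n) (Fin n) ℂ) :=
    Literature.MathematicalPhysics.QuantumLattice.frobeniusInnerProductSpace
  refine le_trans ?_ (norm_half_sub_conjTranspose_le W)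
  have hP : suProj W + (((1 / (2 * n) : ℂ) * (W - Wᴴ).trace) • (1 : Matrix (Fin n) (Fin n) ℂ)) =
      (1 / 2 : ℂ) • (W - Wᴴ) := by
    rw [suProj_def, sub_add_cancel]
  have horth : inner ℝ (suProj W) ((((1 / (2 * n) : ℂ) * (W - Wᴴ).trace) • (1 : Matrix (Fin n) (Fin n) ℂ))) = 0 := by
    rw [Literature.MathematicalPhysics.QuantumLattice.frobenius_inner_def, Matrix.mul_smul, Matrix.mul_one, trace_smul,
      trace_conjTranspose, trace_suProj, star_zero, smul_zero, Complex.zero_re]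
  have hsq : ‖(1 / 2 : ℂ) • (W - Wᴴ)‖ ^ 2 =
      ‖suProj W‖ ^ 2 + ‖(((1 / (2 * n) : ℂ) * (W - Wᴴ).trace) • (1 : Matrix (Fin n) (Fin n) ℂ))‖ ^ 2 := by
    rw [← hP, norm_add_sq_real, horth]; ring
  refine (pow_le_pow_iff_left₀ (norm_nonneg _) (norm_nonneg _) two_ne_zero).1 ?_
  rw [hsq]
  exact le_add_of_nonneg_right (sq_nonneg _)

end SuProj

/-! ## §2 `‖Ω_{x,μ}(V)‖ ≤ 2(d − 1)√n` and `‖Z(V)(x, μ)‖ ≤ 2(d − 1)√n` -/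

section Generator

variable {d L n : ℕ}

/-- **`‖Ω_{x,μ}(V)‖ ≤ 2(d − 1)√n`**: the loop sum is a sum over the `d − 1` directions `ν ≠ μ` of two special-unitary
matrices, each of Hilbert–Schmidt norm `√n`. -/
theorem norm_plaquetteLoopSum_le_frobenius (V : GaugeConfig d L (Matrix.specialUnitaryGroup (Fin n) ℂ))
    (x : Site d L) (μ : Fin d) : ‖plaquetteLoopSum V x μ‖ ≤ 2 * ((d : ℝ) - 1) * Real.sqrt n := by
  -- `‖↑P‖ = √n` for `P ∈ SU(n)`: `‖P‖² = Re tr(P†P) = Re tr 1 = n`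
  have hu : ∀ P : Matrix.specialUnitaryGroup (Fin n) ℂ, ‖(P : Matrix (Fin n) (Fin n) ℂ)‖ = Real.sqrt n := by
    intro P
    have h1 : (P : Matrix (Fin n) (Fin n) ℂ)ᴴ * (P : Matrix (Fin n) (Fin n) ℂ) = 1 := by
      simpa only [Matrix.star_eq_conjTranspose] using
        Matrix.mem_unitaryGroup_iff'.1 (Matrix.mem_specialUnitaryGroup_iff.1 P.2).1
    have h2 : ‖(P : Matrix (Fin n) (Fin n) ℂ)‖ ^ 2 = n := by
      rw [Matrix.frobenius_norm_sq_eq_re_trace, h1, Matrix.trace_one, Fintype.card_fin]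
      simp
    rw [← Real.sqrt_sq (norm_nonneg (P : Matrix (Fin n) (Fin n) ℂ)), h2]
  have hterm : ∀ ν : Fin d, ‖(if ν = μ then (0 : Matrix (Fin n) (Fin n) ℂ) else
      (((plaquetteHolonomy V x μ ν : Matrix.specialUnitaryGroup (Fin n) ℂ) : Matrix (Fin n) (Fin n) ℂ) +
        (((V (x - Pi.single ν 1, ν))⁻¹ * plaquetteHolonomy V (x - Pi.single ν 1) ν μ * V (x - Pi.single ν 1, ν) :
          Matrix.specialUnitaryGroup (Fin n) ℂ) : Matrix (Fin n) (Fin n) ℂ)))‖ ≤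
      if ν = μ then (0 : ℝ) else 2 * Real.sqrt n := by
    intro ν
    split_ifs
    · simp
    · exact (norm_add_le _ _).trans (by rw [hu, hu]; linarith)
  have hcount : ∑ ν : Fin d, (if ν = μ then (0 : ℝ) else 2 * Real.sqrt n) = 2 * ((d : ℝ) - 1) * Real.sqrt n := by
    rw [Finset.sum_ite, Finset.sum_const_zero, zero_add, Finset.sum_const, nsmul_eq_mul, Finset.filter_ne',
      Finset.card_erase_of_mem (Finset.mem_univ μ), Finset.card_univ, Fintype.card_fin,
      Nat.cast_pred (Fin.pos μ)]
    ring
  unfold plaquetteLoopSum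
  calc _ ≤ ∑ ν : Fin d, ‖(if ν = μ then (0 : Matrix (Fin n) (Fin n) ℂ) else
      (((plaquetteHolonomy V x μ ν : Matrix.specialUnitaryGroup (Fin n) ℂ) : Matrix (Fin n) (Fin n) ℂ) +
        (((V (x - Pi.single ν 1, ν))⁻¹ * plaquetteHolonomy V (x - Pi.single ν 1) ν μ * V (x - Pi.single ν 1, ν) :
          Matrix.specialUnitaryGroup (Fin n) ℂ) : Matrix (Fin n) (Fin n) ℂ)))‖ := norm_sum_le _ _
    _ ≤ ∑ ν : Fin d, (if ν = μ then (0 : ℝ) else 2 * Real.sqrt n) := Finset.sum_le_sum fun ν _ => hterm ν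
    _ = 2 * ((d : ℝ) - 1) * Real.sqrt n := hcount

/-- **`‖Z(V)(x, μ)‖ ≤ 2(d − 1)√n`** for EVERY `SU(n)` configuration on every torus: the flow generator
`Z = −P(Ω)` (row 16's `flowGen`) in Hilbert–Schmidt norm. -/
theorem norm_flowGen_le (V : GaugeConfig d L (Matrix.specialUnitaryGroup (Fin n) ℂ)) (e : Edge d L) :
    ‖((flowGen V e : suAlgebra n) : Matrix (Fin n) (Fin n) ℂ)‖ ≤ 2 * ((d : ℝ) - 1) * Real.sqrt n := by
  rw [coe_flowGen, norm_neg]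
  exact (norm_suProj_le _).trans (norm_plaquetteLoopSum_le_frobenius V e.1 e.2)

/-- **Four dimensions: `‖Z(V)(x, μ)‖ ≤ 6√n`.** -/
theorem norm_flowGen_le_four (V : GaugeConfig 4 L (Matrix.specialUnitaryGroup (Fin n) ℂ)) (e : Edge 4 L) :
    ‖((flowGen V e : suAlgebra n) : Matrix (Fin n) (Fin n) ℂ)‖ ≤ 6 * Real.sqrt n := by
  have h := norm_flowGen_le V e
  simp only [Nat.cast_ofNat] at h
  linarith

/-- **The engine (`SU(3)`, four dimensions): `‖Z(V)(x, μ)‖ < 52/5 = 10.4`** for every configuration and every link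
(`6√3 = √108 < 10.4`). -/
theorem norm_flowGen_su3_lt (V : GaugeConfig 4 L (Matrix.specialUnitaryGroup (Fin 3) ℂ)) (e : Edge 4 L) :
    ‖((flowGen V e : suAlgebra 3) : Matrix (Fin 3) (Fin 3) ℂ)‖ < 52 / 5 := by
  have h := norm_flowGen_le_four V e
  simp only [Nat.cast_ofNat] at h
  have h3 : Real.sqrt (3 : ℝ) < 26 / 15 := by
    rw [Real.sqrt_lt' (by norm_num)]
    norm_num
  linarith

/-! ## §3 The registers of one RK3 step: every exponent applied to a link has norm `≤ (19/9)·2(d − 1)√n·|ε|` -/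

/-- **Register bound**: if the previous register satisfies `‖X(e)‖ ≤ c` for all `e`, then the updated register
`X'(e) = aε·Z(W)(e) + b·X(e)` satisfies `‖X'(e)‖ ≤ |a|·|ε|·2(d − 1)√n + |b|·c`, whatever the field `W`. -/
theorem norm_rkRegister_le {a b ε c : ℝ} {X : Edge d L → suAlgebra n} (hX : ∀ e, ‖(X e : Matrix (Fin n) (Fin n) ℂ)‖ ≤ c)
    (W : GaugeConfig d L (Matrix.specialUnitaryGroup (Fin n) ℂ)) (e : Edge d L) :
    ‖((rkRegister a b ε X W e : suAlgebra n) : Matrix (Fin n) (Fin n) ℂ)‖ ≤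
      |a| * |ε| * (2 * ((d : ℝ) - 1) * Real.sqrt n) + |b| * c := by
  unfold rkRegister
  rw [Submodule.coe_add, Submodule.coe_smul, Submodule.coe_smul]
  refine (norm_add_le _ _).trans (add_le_add ?_ ?_)
  · rw [norm_smul, Real.norm_eq_abs, abs_mul]
    exact mul_le_mul_of_nonneg_left (norm_flowGen_le W e) (by positivity)
  · rw [norm_smul, Real.norm_eq_abs]
    exact mul_le_mul_of_nonneg_left (hX e) (abs_nonneg b)

/-- **The three registers of Lüscher's step** (`X₁ = ¼εZ(W₀)`, `X₂ = 8/9·εZ(W₁) − 17/9·X₁`, `X₃ = ¾εZ(W₂) − X₂`, as in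
row 16's `wilsonFlowRK3`): with `B = 2(d − 1)√n·|ε|`, `‖X₁(e)‖ ≤ B/4`, `‖X₂(e)‖ ≤ (49/36)B`, `‖X₃(e)‖ ≤ (19/9)B` — so every
Lie-algebra element exponentiated onto a link during one RK3 step has Hilbert–Schmidt norm at most `(19/9)·B`
(for `SU(3)` in four dimensions `< 22·|ε|`). -/
theorem norm_rk3Registers_le (ε : ℝ) (V : GaugeConfig d L (Matrix.specialUnitaryGroup (Fin n) ℂ)) (e : Edge d L) :
    let X₁ := rkRegister (1 / 4) 0 ε (fun _ => (0 : suAlgebra n)) V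
    let X₂ := rkRegister (8 / 9) (-17 / 9) ε X₁ (rkPush X₁ V)
    let X₃ := rkRegister (3 / 4) (-1) ε X₂ (rkPush X₂ (rkPush X₁ V))
    ‖(X₁ e : Matrix (Fin n) (Fin n) ℂ)‖ ≤ 1 / 4 * (2 * ((d : ℝ) - 1) * Real.sqrt n * |ε|) ∧
      ‖(X₂ e : Matrix (Fin n) (Fin n) ℂ)‖ ≤ 49 / 36 * (2 * ((d : ℝ) - 1) * Real.sqrt n * |ε|) ∧
      ‖(X₃ e : Matrix (Fin n) (Fin n) ℂ)‖ ≤ 19 / 9 * (2 * ((d : ℝ) - 1) * Real.sqrt n * |ε|) := by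
  intro X₁ X₂ X₃
  set B := 2 * ((d : ℝ) - 1) * Real.sqrt n with hBdef
  have h1 : ∀ e', ‖(X₁ e' : Matrix (Fin n) (Fin n) ℂ)‖ ≤ 1 / 4 * (B * |ε|) := fun e' => by
    have h : ‖(X₁ e' : Matrix (Fin n) (Fin n) ℂ)‖ ≤ |(1 / 4 : ℝ)| * |ε| * B + |(0 : ℝ)| * 0 :=
      norm_rkRegister_le (a := 1 / 4) (b := 0) (ε := ε) (c := 0) (X := fun _ => (0 : suAlgebra n))
        (fun _ => by simp) V e'
    have e1 : |(1 / 4 : ℝ)| = 1 / 4 := abs_of_pos (by norm_num)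
    rw [e1, abs_zero, zero_mul, add_zero] at h
    linarith
  have h2 : ∀ e', ‖(X₂ e' : Matrix (Fin n) (Fin n) ℂ)‖ ≤ 49 / 36 * (B * |ε|) := fun e' => by
    have h : ‖(X₂ e' : Matrix (Fin n) (Fin n) ℂ)‖ ≤ |(8 / 9 : ℝ)| * |ε| * B + |(-17 / 9 : ℝ)| * (1 / 4 * (B * |ε|)) :=
      norm_rkRegister_le (a := 8 / 9) (b := -17 / 9) (ε := ε) h1 (rkPush X₁ V) e'
    have e1 : |(8 / 9 : ℝ)| = 8 / 9 := abs_of_pos (by norm_num)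
    have e2 : |(-17 / 9 : ℝ)| = 17 / 9 := by rw [abs_of_neg (by norm_num)]; norm_num
    rw [e1, e2] at h
    linarith
  have h3 : ‖(X₃ e : Matrix (Fin n) (Fin n) ℂ)‖ ≤ 19 / 9 * (B * |ε|) := by
    have h : ‖(X₃ e : Matrix (Fin n) (Fin n) ℂ)‖ ≤ |(3 / 4 : ℝ)| * |ε| * B + |(-1 : ℝ)| * (49 / 36 * (B * |ε|)) :=
      norm_rkRegister_le (a := 3 / 4) (b := -1) (ε := ε) h2 (rkPush X₂ (rkPush X₁ V)) e
    have e1 : |(3 / 4 : ℝ)| = 3 / 4 := abs_of_pos (by norm_num)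
    have e2 : |(-1 : ℝ)| = 1 := by norm_num
    rw [e1, e2] at h
    linarith
  exact ⟨h1 e, h2 e, h3⟩

end Generator

end Summit.Ventures.LatticeQCDFlow.Scoring
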